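import Summits.HodgeConjecture.HodgeConjecture.Theorems.Ring2AtlasCMSixfolds
import Summits.HodgeConjecture.HodgeConjecture.Theorems.Ring2HypothesesAtlasSixfolds
import Literature.AlgebraicGeometry.HodgeTheory.HodgeGroupProductCMFactorClasses
import HarnessLib

/-!
# Ring 2 — hypotheses layer, part XVI: the simple CM sixfold row of atlas-2 served WITHOUT `HC_CM`

HONEST FRAMING: research route conditional on HC_CM; not a corollary; Q11.4-sentence-2 already refuted in dim ≥ 3.

Cell `pub-hodge-ring2`, seat `pub-hodge-ring2-typer2`, gen 10; the hypotheses-axis service ((c6) typed inputs,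
(c7) KIND of `HC_CM`) for the generation-2 cells of `Ring2AtlasCMSixfolds` (atlas-2): `HodgeDegenerateCMSixfold`,
`HodgeNondegenerateCMSixfold`, `HodgeSimpleCMSixfold` (+ the `g = 7` row under Tankeev–Ribet). `HC_CM` is the binder
`(hCM : Theses.RankFourFaces.CMAbelianHodge)` (item stmt-HodgeConjecture-3052) BY NAME; `W₆` is the route item
`Theses.SevenfoldWeilCensus.WeilSixfolds` (stmt-HodgeConjecture-2524) BY NAME. Theorems only: no `def`, nothing
asserted, no fact minted — the census statements of atlas-2's docstrings enter as HYPOTHESES ON THE MEMBER.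

## What this file adds

Atlas-2 closes its simple-CM-sixfold cells only from `HC_CM` (`…_of_cmAbelianHodge`: KIND = IS-THE-HYPOTHESIS,
every member being a CM abelian variety). Part XIV's engine (`hodgeConjectureFor_of_isDivisorMultiWeilGenerated`:
`HC(A)` from "`B•(A) ⊆ D•(A) + Σ_k W_k`" and the algebraicity of the Weil classes of every Weil structure of `A`)
serves them on the hypotheses axis instead:

* §1 **DEGENERATE cell** `HodgeDegenerateCMSixfold` (simple CM sixfold with a balanced `(3,3)` imaginary quadratic
  `k ⊂ End⁰`) ⟸ (G) the census's Hodge-ring shape `B•(A) = D•(A) ⊕ W_k` typed as `IsDivisorMultiWeilGenerated A`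
  (or, literally, typer 1's `IsDivisorWeilGenerated A φ 3 d` for the balanced structure) + (W) `W₆` — or + `R∞`.
  `HC_CM` is NOT an input. With part XIV §3 the (W) input is itself reached `HC_CM`-free from divisor-generated /
  CM-elliptic-power pointed δ-families + the δ-VHC of the `(3, d, δ)` components (rows W1′ / W1‴), or with `HC_CM`
  NOMINAL (row W1).
* §2 **NONDEGENERATE cell** `HodgeNondegenerateCMSixfold` ⟸ (G₀) `B•(A) = D•(A)` on the member (`IsDivisorGenerated`,
  Hazama's theorem for CM type of maximal rank `dim A + 1 = 7`, Gordon's survey Thm. 6.4, + the census "no balanced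
  `k` ⟺ rank 7"): a THEOREM of the tree modulo the typed member hypothesis (van Geemen §2.4, Lefschetz (1,1)) — no
  Weil input, no `HC_CM`.
* §3 **The row** `HodgeSimpleCMSixfold` ⟸ (G₀) + (G) + `W₆`, and both simple CM rows (`g = 6, 7`) ⟸ the same +
  Tankeev–Ribet; the fully spelled `HC_CM`-free composition down to the δ-leaves.
* §4 **Exactness / on path**: given (G), the degenerate cell is EQUIVALENT to "all Weil classes of every degenerate
  simple CM sixfold are algebraic" (`allWeilClasses A p ≤ Nᵖ`); the generic form for any class `𝒞`.
* §5 **KIND verdict** for RING2-MAP (c7), as one theorem: on the simple CM sixfold row `HC_CM` is IS-THE-HYPOTHESIS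
  formally but DISPENSABLE — the row follows from (G₀), (G) and `W₆` with no `HC_CM`; inside `g = 6` it stays
  load-bearing only OFF the simple row (non-simple CM sixfolds, e.g. `E × (Weil-type CM fivefold)`, part XIV §5) and,
  nominally, inside `W₆`'s own W1 row.

Honest column: (G), (G₁), (G₀) are the census's / Hazama's Hodge-ring computations entered as hypotheses on members
(two implementations in the cell, NOT tree facts; (G₀) is a refereed theorem in print given the census identification);
`W₆` is OPEN off the hyperbolic `ℚ(√-1), ℚ(√-3)` components (Schoen, Koike) and the split components mod the
UNREFEREED Markman 2025; nothing here makes a Weil class algebraic. If some sextic CM field had two balanced quadratic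
subfields with distinct Weil planes, (G₁) would fail structure by structure and (G) is the right input — the census's
`dim B³ = 22 = 20 + 2` says this does not occur.

## References

* [MoonenZarhin1999LowDim] B. Moonen, Yu. Zarhin, Hodge classes on abelian varieties of low dimension, Math. Ann. 315
  (1999) 711–733, (1.8), §2 Thm. (2.7), §5. [MoonenZarhin1998WeilClasses] §1, Criterion (4.1).
* [vanGeemen1994HodgeAV] B. van Geemen, An introduction to the Hodge conjecture for abelian varieties, LNM 1594
  (1994), §2.4, 4.9–4.13, Lemma 5.2, Thm. 6.12. [Gordon1997] B. Gordon, A survey of the Hodge conjecture for abelian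
  varieties, alg-geom/9709030, Thm. 6.4 (Hazama), Thm. 7.5. [Hazama1989] F. Hazama, J. Fac. Sci. Univ. Tokyo 31 (1985)
  487–520, Introduction. [Dodson1984] B. Dodson, Trans. AMS 283 (1984), §3.1, §5. [Ribet1983] K. Ribet, Amer. J.
  Math. 105 (1983), Thms. 0–3. [Schoen1988HodgeWeil] Thm. 0.2; [Koike2004WeilHodge] Thm. 2.1;
  [Markman2025SecantWeil] Thm. 1.5.1 (UNREFEREED). [Deligne1982HodgeCycles] §4 Prop. 4.4, Thm. 4.8, §5. [Deligne2000] §1.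
-/

set_option linter.dupNamespace false

noncomputable section

open CategoryTheory
open Literature.AlgebraicGeometry Literature.AlgebraicGeometry.Motives
open Literature.AlgebraicGeometry.HodgeTheory
open Literature.AlgebraicTopology.SingularHomology
open Literature.AlgebraicGeometry.Milne1999 (IsOfCMType)
open Summit.HodgeConjecture.HodgeConjecture.WeilTypeLadder
open Summit.HodgeConjecture.HodgeConjecture.Theses
open Summit.HodgeConjecture.HodgeConjecture.Ring2.ClassTargets
open Summit.HodgeConjecture.HodgeConjecture.Ring2.Atlas

namespace Summit.HodgeConjecture.HodgeConjecture.Ring2.Hypotheses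

/-! ### §1 The DEGENERATE cell from (G) + (W) — `HC_CM` not an input -/

/-- **Degenerate simple CM sixfolds ⟸ (G) `B• ⊆ D• + Σ_k W_k` on members + (W) `W₆`.** For a simple CM sixfold with
a balanced `(3,3)` quadratic endomorphism, the census gives `B•(A) = D•(A) ⊕ W_k` (typed on the member as
`IsDivisorMultiWeilGenerated A`, a HYPOTHESIS); `D• ⊆ N•` by Lefschetz (1,1) and products (tree theorem), `W_k ⊆ N³`
by `W₆`. `HC_CM` does not occur. [cite: MoonenZarhin1999LowDim, §5] [cite: vanGeemen1994HodgeAV, Thm. 6.12 and 4.11]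
[cite: Dodson1984, §3.1 and §5] -/
theorem hodgeDegenerateCMSixfold_of_multiWeilGenerated_of_weilSixfolds
    (hgen : ∀ A, IsSimpleCMSixfold A → HasBalancedQuadraticEndomorphism A → IsDivisorMultiWeilGenerated A)
    (hW₆ : SevenfoldWeilCensus.WeilSixfolds) : HodgeDegenerateCMSixfold :=
  hcOnClass_of_multiWeilGenerated_of_weilSixfolds (fun _ h ↦ h.1.1) (fun A h ↦ hgen A h.1 h.2) hW₆

/-- **The same cell ⟸ (G₁) the census statement LITERALLY — `B• = D• ⊕ W_k` for the balanced structure `(φ, d)`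
itself (typer 1's `IsDivisorWeilGenerated A φ 3 d`) — + (W) `W₆`.** The balanced `(φ, d)` of the binder is a Weil
structure of type `(3, d)` (bridge `isWeilType_of_eigenMultiplicity_eq`), so (G₁) gives (G).
[cite: vanGeemen1994HodgeAV, 4.9 and Thm. 6.12] [cite: MoonenZarhin1999LowDim, §5] -/
theorem hodgeDegenerateCMSixfold_of_isDivisorWeilGenerated_of_weilSixfolds
    (hgen₁ : ∀ (A : AbelianVariety ℂ) (φ : A ⟶ A) (d : ℕ), IsSimpleCMSixfold A → 0 < d → φ ≫ φ = -(d • 𝟙 A) →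
      eigenMultiplicity A φ (Complex.I * (Real.sqrt d : ℂ)) = 3 → IsDivisorWeilGenerated A φ 3 d)
    (hW₆ : SevenfoldWeilCensus.WeilSixfolds) : HodgeDegenerateCMSixfold := by
  refine hodgeDegenerateCMSixfold_of_multiWeilGenerated_of_weilSixfolds (fun A hA hb ↦ ?_) hW₆
  obtain ⟨φ, d, hd, hφ, hm⟩ := hb
  have hWT : IsWeilType A φ 3 d := isWeilType_of_eigenMultiplicity_eq (by norm_num) hd hA.1 hφ hm
  exact isDivisorMultiWeilGenerated_of_isDivisorWeilGenerated hWT (hgen₁ A φ d hA hd hφ hm)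

/-- **The same cell ⟸ (G) + the imaginary-quadratic rung `R∞` (`WeilClassesImaginaryQuadratic`)** in place of `W₆`.
[cite: Deligne1982HodgeCycles, §4 Thm. 4.8] [cite: vanGeemen1994HodgeAV, Thm. 6.12] -/
theorem hodgeDegenerateCMSixfold_of_multiWeilGenerated_of_weilClassesImaginaryQuadratic
    (hgen : ∀ A, IsSimpleCMSixfold A → HasBalancedQuadraticEndomorphism A → IsDivisorMultiWeilGenerated A)
    (hR : WeilClassesImaginaryQuadratic) : HodgeDegenerateCMSixfold :=
  hcOnClass_of_multiWeilGenerated_of_weilClassesImaginaryQuadratic (fun A h ↦ hgen A h.1 h.2) hR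

/-- **Degenerate cell, `HC_CM`-FREE down to the leaves (row W1′)**: (G) + van Geemen's Lemma 5.2 supply statement +
divisor-generated-CM-pointed `(3, d, δ)`-families + the δ-VHC of every component. [cite: vanGeemen1994HodgeAV, Thm. 4.3, Lemma 5.2 and Thm. 6.12]
[cite: Abdulali1994FamiliesAV, (1.1) and Lemma 6.2] [cite: Deligne1982HodgeCycles, §5] -/
theorem hodgeDegenerateCMSixfold_of_multiWeilGenerated_of_divisorGeneratedCMPointed
    (hgen : ∀ A, IsSimpleCMSixfold A → HasBalancedQuadraticEndomorphism A → IsDivisorMultiWeilGenerated A)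
    (hE : PolarizedWeilDiscriminantExists)
    (hP : ∀ d : ℕ, 0 < d → ∀ δ, DivisorGeneratedCMPointedWeilFamiliesComponent 3 d δ)
    (hV : ∀ d : ℕ, 0 < d → ∀ δ, WeilVariationalHodgeComponent 3 d δ) : HodgeDegenerateCMSixfold :=
  hodgeDegenerateCMSixfold_of_multiWeilGenerated_of_weilSixfolds hgen (weilSixfolds_of_divisorGeneratedCMPointed hE hP hV)

/-- **Degenerate cell, `HC_CM` DISCHARGED by Tate (row W1‴)**: families through a CM-elliptic power `E⁶`.
[cite: vanGeemen1994HodgeAV, Thm. 4.3 and 5.7–5.11] [cite: Schoen1988HodgeWeil, §6] -/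
theorem hodgeDegenerateCMSixfold_of_multiWeilGenerated_of_cmPowerPointed
    (hgen : ∀ A, IsSimpleCMSixfold A → HasBalancedQuadraticEndomorphism A → IsDivisorMultiWeilGenerated A)
    (hE : PolarizedWeilDiscriminantExists)
    (hP : ∀ d : ℕ, 0 < d → ∀ δ, CMPowerPointedWeilFamiliesComponent 3 d δ)
    (hV : ∀ d : ℕ, 0 < d → ∀ δ, WeilVariationalHodgeComponent 3 d δ) : HodgeDegenerateCMSixfold :=
  hodgeDegenerateCMSixfold_of_multiWeilGenerated_of_weilSixfolds hgen (weilSixfolds_of_cmPowerPointed hE hP hV)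

/-- **Degenerate cell with `HC_CM` NOMINAL (row W1)**: any CM-pointed `(3, d, δ)`-families; `HC_CM` only anchors the
CM fibre. [cite: Deligne1982HodgeCycles, §5] [cite: Abdulali1994FamiliesAV, Lemma 6.2] -/
theorem hodgeDegenerateCMSixfold_of_HC_CM_of_multiWeilGenerated_of_cmPointed (hCM : RankFourFaces.CMAbelianHodge)
    (hgen : ∀ A, IsSimpleCMSixfold A → HasBalancedQuadraticEndomorphism A → IsDivisorMultiWeilGenerated A)
    (hE : PolarizedWeilDiscriminantExists) (hP : ∀ d : ℕ, 0 < d → ∀ δ, CMPointedWeilFamiliesComponent 3 d δ)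
    (hV : ∀ d : ℕ, 0 < d → ∀ δ, WeilVariationalHodgeComponent 3 d δ) : HodgeDegenerateCMSixfold :=
  hodgeDegenerateCMSixfold_of_multiWeilGenerated_of_weilSixfolds hgen (weilSixfolds_of_HC_CM hCM hE hP hV)

/-! ### §2 The NONDEGENERATE cell from (G₀) alone -/

/-- **Nondegenerate simple CM sixfolds ⟸ (G₀) `B•(A) = D•(A)` on members** (Hazama: a simple CM abelian variety of
maximal rank `dim A + 1` has `Hdg(Aⁿ) = Div(Aⁿ)` for all `n`; census: no balanced `k` ⟺ rank 7), typed as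
`IsDivisorGenerated A`; then `HC(A)` is the tree THEOREM `hodgeConjectureFor_of_isDivisorGenerated` (van Geemen §2.4,
Lefschetz (1,1)). No Weil input, no `HC_CM`. [cite: Gordon1997, Thm. 6.4 (Hazama) and Thm. 7.5] [cite: Hazama1989, Introduction]
[cite: vanGeemen1994HodgeAV, §2.4] [cite: Dodson1984, §3.1] -/
theorem hodgeNondegenerateCMSixfold_of_isDivisorGenerated
    (hgen₀ : ∀ A, IsSimpleCMSixfold A → ¬ HasBalancedQuadraticEndomorphism A → IsDivisorGenerated A) :
    HodgeNondegenerateCMSixfold :=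
  fun A hA ↦ hodgeConjectureFor_of_isDivisorGenerated A (hgen₀ A hA.1 hA.2)

/-! ### §3 The row, both simple CM rows, and the spelled-out `HC_CM`-free composition -/

/-- **Row `g = 6`, simple, CM-type ⟸ (G₀) + (G) + `W₆`** — `HC_CM` is NOT an input. [cite: MoonenZarhin1999LowDim, §5]
[cite: Gordon1997, Thm. 6.4] [cite: vanGeemen1994HodgeAV, §2.4 and Thm. 6.12] -/
theorem hodgeSimpleCMSixfold_of_generation_of_weilSixfolds
    (hgen₀ : ∀ A, IsSimpleCMSixfold A → ¬ HasBalancedQuadraticEndomorphism A → IsDivisorGenerated A)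
    (hgen : ∀ A, IsSimpleCMSixfold A → HasBalancedQuadraticEndomorphism A → IsDivisorMultiWeilGenerated A)
    (hW₆ : SevenfoldWeilCensus.WeilSixfolds) : HodgeSimpleCMSixfold :=
  hodgeSimpleCMSixfold_iff.mpr ⟨hodgeDegenerateCMSixfold_of_multiWeilGenerated_of_weilSixfolds hgen hW₆,
    hodgeNondegenerateCMSixfold_of_isDivisorGenerated hgen₀⟩

/-- **Both simple CM rows (`g = 6` and `g = 7`) ⟸ (G₀) + (G) + `W₆` + Tankeev–Ribet** (refereed fact by name for the
prime dimension `7`). [cite: Ribet1983, Thms. 0–3] [cite: MoonenZarhin1999LowDim, §2 Thm. (2.7) and §5] [cite: Gordon1997, Thm. 6.4] -/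
theorem simpleCMRows_of_generation_of_weilSixfolds_of_tankeevRibet
    (hTR : TankeevRibet1983_hodgeClasses_divisorial_powers_simplePrimeDimension)
    (hgen₀ : ∀ A, IsSimpleCMSixfold A → ¬ HasBalancedQuadraticEndomorphism A → IsDivisorGenerated A)
    (hgen : ∀ A, IsSimpleCMSixfold A → HasBalancedQuadraticEndomorphism A → IsDivisorMultiWeilGenerated A)
    (hW₆ : SevenfoldWeilCensus.WeilSixfolds) : HodgeSimpleCMSixfold ∧ HodgeSimpleCMSevenfold :=
  (simpleCMRows_iff_of_tankeevRibet hTR).mpr ⟨hodgeDegenerateCMSixfold_of_multiWeilGenerated_of_weilSixfolds hgen hW₆,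
    hodgeNondegenerateCMSixfold_of_isDivisorGenerated hgen₀⟩

/-- **The row `HC_CM`-FREE down to the leaves**: (G₀) + (G) + supply statement + divisor-generated-CM-pointed
`(3, d, δ)`-families + δ-VHC. Every hypothesis is typed and OPEN or census-derived; none is `HC_CM`.
[cite: vanGeemen1994HodgeAV, §2.4, Lemma 5.2 and Thm. 6.12] [cite: Abdulali1994FamiliesAV, Lemma 6.2] [cite: Gordon1997, Thm. 6.4] -/
theorem hodgeSimpleCMSixfold_of_generation_of_divisorGeneratedCMPointed
    (hgen₀ : ∀ A, IsSimpleCMSixfold A → ¬ HasBalancedQuadraticEndomorphism A → IsDivisorGenerated A)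
    (hgen : ∀ A, IsSimpleCMSixfold A → HasBalancedQuadraticEndomorphism A → IsDivisorMultiWeilGenerated A)
    (hE : PolarizedWeilDiscriminantExists)
    (hP : ∀ d : ℕ, 0 < d → ∀ δ, DivisorGeneratedCMPointedWeilFamiliesComponent 3 d δ)
    (hV : ∀ d : ℕ, 0 < d → ∀ δ, WeilVariationalHodgeComponent 3 d δ) : HodgeSimpleCMSixfold :=
  hodgeSimpleCMSixfold_of_generation_of_weilSixfolds hgen₀ hgen (weilSixfolds_of_divisorGeneratedCMPointed hE hP hV)

/-! ### §4 Exactness and on-path lemmas -/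

/-- **Generic exactness**: on a class `𝒞` whose members satisfy (G), `HC` on `𝒞` is EQUIVALENT to the algebraicity
of ALL Weil classes of every member (`allWeilClasses A p ≤ Nᵖ` for all `p`). (`→`: on path, Deligne Prop. 4.4;
`←`: part XIV's engine.) [cite: Deligne1982HodgeCycles, §4 Prop. 4.4] [cite: vanGeemen1994HodgeAV, Thm. 6.12] -/
theorem hcOnClass_iff_allWeilClasses_algebraic_of_multiWeilGenerated {𝒞 : AbelianVariety ℂ → Prop}
    (hgen : ∀ A, 𝒞 A → IsDivisorMultiWeilGenerated A) :
    HCOnClass 𝒞 ↔ ∀ A, 𝒞 A → ∀ p, allWeilClasses A p ≤ algebraicClasses A.X p :=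
  ⟨fun h A hA p ↦ allWeilClasses_le_algebraicClasses_of_hodgeConjectureFor (h A hA) p,
    fun h A hA ↦ hodgeConjectureFor_of_isDivisorMultiWeilGenerated (hgen A hA)
      fun p _ _ hW _ hc _ _ ↦ h A hA p (weilClassesOf_le_allWeilClasses hW hc)⟩

/-- **ON PATH for the degenerate cell**: under `HodgeDegenerateCMSixfold` all Weil classes of every degenerate simple
CM sixfold are algebraic. [cite: Deligne1982HodgeCycles, §4 Prop. 4.4] -/
theorem allWeilClasses_le_algebraicClasses_of_hodgeDegenerateCMSixfold (h : HodgeDegenerateCMSixfold)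
    (A : AbelianVariety ℂ) (hA : IsSimpleCMSixfold A) (hb : HasBalancedQuadraticEndomorphism A) (p : ℕ) :
    allWeilClasses A p ≤ algebraicClasses A.X p :=
  allWeilClasses_le_algebraicClasses_of_hodgeConjectureFor (h A ⟨hA, hb⟩) p

/-- **EXACTNESS of the degenerate cell given (G)**: `HodgeDegenerateCMSixfold` ⟺ the Weil classes of every Weil
structure of every degenerate simple CM sixfold are algebraic. So, granted the census's Hodge-ring shape, the cell IS
the CM slice of `W₆` — nothing more, nothing less. [cite: MoonenZarhin1999LowDim, §5] [cite: vanGeemen1994HodgeAV, Thm. 6.12] -/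
theorem hodgeDegenerateCMSixfold_iff_allWeilClasses_algebraic_of_multiWeilGenerated
    (hgen : ∀ A, IsSimpleCMSixfold A → HasBalancedQuadraticEndomorphism A → IsDivisorMultiWeilGenerated A) :
    HodgeDegenerateCMSixfold ↔ ∀ A, IsSimpleCMSixfold A → HasBalancedQuadraticEndomorphism A →
      ∀ p, allWeilClasses A p ≤ algebraicClasses A.X p :=
  ⟨fun h A hA hb p ↦ allWeilClasses_le_algebraicClasses_of_hodgeConjectureFor (h A ⟨hA, hb⟩) p,
    fun h ↦ (hcOnClass_iff_allWeilClasses_algebraic_of_multiWeilGenerated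
      (𝒞 := fun A ↦ IsSimpleCMSixfold A ∧ HasBalancedQuadraticEndomorphism A) fun A h' ↦ hgen A h'.1 h'.2).2
      fun A hA p ↦ h A hA.1 hA.2 p⟩

/-- **EXACTNESS of the nondegenerate cell given (G₀)**: it holds outright (no further input), so `HC_CM` restricted
to nondegenerate simple CM sixfolds is DECIDED modulo the typed member hypothesis. [cite: Gordon1997, Thm. 6.4] -/
theorem hodgeNondegenerateCMSixfold_iff_true_of_isDivisorGenerated
    (hgen₀ : ∀ A, IsSimpleCMSixfold A → ¬ HasBalancedQuadraticEndomorphism A → IsDivisorGenerated A) :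
    HodgeNondegenerateCMSixfold ↔ True :=
  iff_true_intro (hodgeNondegenerateCMSixfold_of_isDivisorGenerated hgen₀)

/-! ### §5 KIND verdict for RING2-MAP (c7) -/

/-- **KIND of `HC_CM` on the simple CM sixfold row — IS-THE-HYPOTHESIS formally, DISPENSABLE in fact.** One
conjunction: (i) `HC_CM` gives the row (atlas-2, by name); (ii) WITHOUT `HC_CM`, (G₀) + (G) + `W₆` give the row;
(iii) WITHOUT `HC_CM` and without `W₆` as such, (G₀) + (G) + the supply statement + divisor-generated-CM-pointed
δ-families + δ-VHC give the row; (iv) conversely the row gives, on its degenerate cell, the algebraicity of all Weil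
classes (the CM slice of `W₆`). [cite: Milne1999, §7 (H)] [cite: MoonenZarhin1999LowDim, §5] [cite: Gordon1997, Thm. 6.4]
[cite: vanGeemen1994HodgeAV, Lemma 5.2 and Thm. 6.12] -/
theorem hodgeSimpleCMSixfold_kind
    (hgen₀ : ∀ A, IsSimpleCMSixfold A → ¬ HasBalancedQuadraticEndomorphism A → IsDivisorGenerated A)
    (hgen : ∀ A, IsSimpleCMSixfold A → HasBalancedQuadraticEndomorphism A → IsDivisorMultiWeilGenerated A) :
    (RankFourFaces.CMAbelianHodge → HodgeSimpleCMSixfold) ∧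
    (SevenfoldWeilCensus.WeilSixfolds → HodgeSimpleCMSixfold) ∧
    (PolarizedWeilDiscriminantExists → (∀ d : ℕ, 0 < d → ∀ δ, DivisorGeneratedCMPointedWeilFamiliesComponent 3 d δ) →
      (∀ d : ℕ, 0 < d → ∀ δ, WeilVariationalHodgeComponent 3 d δ) → HodgeSimpleCMSixfold) ∧
    (HodgeSimpleCMSixfold → ∀ A, IsSimpleCMSixfold A → HasBalancedQuadraticEndomorphism A →
      ∀ p, allWeilClasses A p ≤ algebraicClasses A.X p) :=
  ⟨hodgeSimpleCMSixfold_of_cmAbelianHodge, hodgeSimpleCMSixfold_of_generation_of_weilSixfolds hgen₀ hgen,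
    hodgeSimpleCMSixfold_of_generation_of_divisorGeneratedCMPointed hgen₀ hgen,
    fun h A hA _ p ↦ allWeilClasses_le_algebraicClasses_of_hodgeConjectureFor (h A hA) p⟩

end Summit.HodgeConjecture.HodgeConjecture.Ring2.Hypotheses

end
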